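import Mathlib
import Literature.MathematicalPhysics.QuantumLattice.OverlapLocality
import Literature.MathematicalPhysics.QuantumLattice.LatticeToriProofs
import Summits.QuantumFields.QCD.Theorems.SpectralDefectExtinctionExtinctionBuildsQCDStubWindowModesLocalisedAux2

/-!
# A patch system on the four-torus (support for stub `stub_windowModesLocalised`)
(line `block-away-the-sign`, crux `Summit.QuantumFields.QCD.Theses.SpectralDefectExtinction.ExtinctionBuildsQCD`,
item stmt-QuantumFields-18064)

From the circle partition of `…StubWindowModesLocalisedAux2` (block map `β : ZMod L → ZMod n`, quadratic partition
of unity `χ_j`, `j ∈ ZMod n`) we build, on the periodic lattice `TorusSite 4 L = (ZMod L)⁴` with the taxi distance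
`torusTaxiDist`, the PATCH SYSTEM consumed by the IMS/Agmon assembly of the stub: patches are indexed by
`J ∈ (ZMod n)⁴`, the partition functions are the products `χ_J(x) = Π_μ χ_{J μ}(x μ)` (so `Σ_J χ_J² = 1` and the
one-step Lipschitz bound `Σ_J (χ_J(x + e_μ) − χ_J(x))² ≤ 8/r²` is inherited from one coordinate), the enlarged boxes
are `B⁺_J = {x | ∀ μ, β(x μ) ∈ {J μ, J μ − 1}} ⊇ supp χ_J` (`|B⁺_J| ≤ (4r)⁴`), and two patches are CLOSE when all
coordinates of `J − J'` have cyclic absolute value `≤ 4` (at most `9⁴` patches are close to a given one); boxes of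
patches that are not close are at taxi distance `≥ 3`.  Export: `stub_windowModesLocalisedAux3` (existence statement).
-/

noncomputable section

namespace Summit.QuantumFields.QCD.Cruxes.ExtinctionBuildsQCD.BlockAwayTheSign

open scoped BigOperators Classical
open Finset Literature.MathematicalPhysics.QuantumLattice Literature.Probability.LatticeModels

namespace WindowModes

section Torus

variable {L n : ℕ}

/-- One coordinate of the taxi distance is at most the taxi distance. -/
theorem cycAbs_apply_le_torusTaxiDist (x y : TorusSite 4 L) (μ : Fin 4) :
    min (x μ - y μ).val (L - (x μ - y μ).val) ≤ torusTaxiDist x y :=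
  Finset.single_le_sum (f := fun i => min (x i - y i).val (L - (x i - y i).val)) (fun _ _ => Nat.zero_le _)
    (mem_univ μ)

/-- `Σ_J Π_μ g μ (J μ) = Π_μ Σ_j g μ j` over `J : Fin 4 → ZMod n`. -/
theorem sum_prod_eq_prod_sum [NeZero n] (g : Fin 4 → ZMod n → ℝ) :
    ∑ J : Fin 4 → ZMod n, ∏ μ, g μ (J μ) = ∏ μ : Fin 4, ∑ j : ZMod n, g μ j := by
  rw [Finset.prod_univ_sum, Fintype.piFinset_univ]

variable (β : ZMod L → ZMod n) (χ₁ : ZMod n → ZMod L → ℝ)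

/-- `Σ_J χ_J(x)² = 1` for the product partition. -/
theorem sum_prod_chi_sq [NeZero n] (h1 : ∀ t, ∑ j, χ₁ j t ^ 2 = 1) (x : TorusSite 4 L) :
    ∑ J : Fin 4 → ZMod n, (∏ μ, χ₁ (J μ) (x μ)) ^ 2 = 1 := by
  have : ∑ J : Fin 4 → ZMod n, (∏ μ, χ₁ (J μ) (x μ)) ^ 2 =
      ∑ J : Fin 4 → ZMod n, ∏ μ, χ₁ (J μ) (x μ) ^ 2 :=
    Finset.sum_congr rfl fun J _ => (Finset.prod_pow _ _ _).symm
  rw [this, sum_prod_eq_prod_sum (fun μ j => χ₁ j (x μ) ^ 2)]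
  simp [h1]

/-- The support of `χ_J` lies in the enlarged box `B⁺_J`. -/
theorem mem_box_of_prod_chi_ne_zero [NeZero L] (hne : ∀ j t, χ₁ j t ≠ 0 → β t = j ∨ β t + 1 = j)
    (J : Fin 4 → ZMod n) (x : TorusSite 4 L) (h : ∏ μ, χ₁ (J μ) (x μ) ≠ 0) :
    x ∈ univ.filter (fun x : TorusSite 4 L => ∀ μ, β (x μ) = J μ ∨ β (x μ) + 1 = J μ) := by
  rw [mem_filter]
  exact ⟨mem_univ _, fun μ => hne _ _ (Finset.prod_ne_zero_iff.mp h μ (mem_univ μ))⟩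

/-- **One-step Lipschitz bound of the product partition**: `Σ_J (χ_J(x + e_μ) − χ_J(x))² ≤ 8/r²`. -/
theorem sum_prod_chi_step_sq_le [NeZero L] [NeZero n] (r : ℕ) (h1 : ∀ t, ∑ j, χ₁ j t ^ 2 = 1)
    (hstep : ∀ t, ∑ j, (χ₁ j (t + 1) - χ₁ j t) ^ 2 ≤ 8 / (r : ℝ) ^ 2) (x : TorusSite 4 L) (μ : Fin 4) :
    ∑ J : Fin 4 → ZMod n, (∏ ν, χ₁ (J ν) ((x + Pi.single μ 1 : TorusSite 4 L) ν) - ∏ ν, χ₁ (J ν) (x ν)) ^ 2 ≤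
      8 / (r : ℝ) ^ 2 := by
  set g : Fin 4 → ZMod n → ℝ := fun ν j =>
    if ν = μ then (χ₁ j (x μ + 1) - χ₁ j (x μ)) ^ 2 else χ₁ j (x ν) ^ 2 with hg
  have hx' : ∀ ν, ν ≠ μ → (x + Pi.single μ 1 : TorusSite 4 L) ν = x ν := fun ν hν => by
    rw [Pi.add_apply, Pi.single_eq_of_ne hν, add_zero]
  have hxμ : (x + Pi.single μ 1 : TorusSite 4 L) μ = x μ + 1 := by rw [Pi.add_apply, Pi.single_eq_same]
  have hpt : ∀ J : Fin 4 → ZMod n,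
      (∏ ν, χ₁ (J ν) ((x + Pi.single μ 1 : TorusSite 4 L) ν) - ∏ ν, χ₁ (J ν) (x ν)) ^ 2 = ∏ ν, g ν (J ν) := by
    intro J
    set P := ∏ ν ∈ univ.erase μ, χ₁ (J ν) (x ν) with hP
    have hA : ∏ ν, χ₁ (J ν) ((x + Pi.single μ 1 : TorusSite 4 L) ν) = χ₁ (J μ) (x μ + 1) * P := by
      rw [← Finset.mul_prod_erase univ _ (mem_univ μ), hxμ]
      congr 1
      exact Finset.prod_congr rfl fun ν hν => by rw [hx' ν (Finset.ne_of_mem_erase hν)]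
    have hB : ∏ ν, χ₁ (J ν) (x ν) = χ₁ (J μ) (x μ) * P := by
      rw [← Finset.mul_prod_erase univ _ (mem_univ μ)]
    have hC : ∏ ν, g ν (J ν) = (χ₁ (J μ) (x μ + 1) - χ₁ (J μ) (x μ)) ^ 2 * P ^ 2 := by
      rw [← Finset.mul_prod_erase univ _ (mem_univ μ)]
      simp only [hg, if_true]
      congr 1
      rw [hP, ← Finset.prod_pow]
      exact Finset.prod_congr rfl fun ν hν => by rw [if_neg (Finset.ne_of_mem_erase hν)]
    rw [hA, hB, hC]; ring
  rw [Finset.sum_congr rfl fun J _ => hpt J, sum_prod_eq_prod_sum g,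
    ← Finset.mul_prod_erase univ _ (mem_univ μ)]
  have hrest : ∏ ν ∈ univ.erase μ, ∑ j, g ν j = 1 := by
    refine Finset.prod_eq_one fun ν hν => ?_
    simp only [hg, if_neg (Finset.ne_of_mem_erase hν), h1]
  rw [hrest, mul_one]
  simp only [hg, if_true]
  exact hstep (x μ)

/-- **Separation**: if `J, J'` are not close then their enlarged boxes are at taxi distance `≥ 3`. -/
theorem three_le_torusTaxiDist_of_not_close [NeZero L] [NeZero n]
    (hβ2 : ∀ s t : ZMod L, min (s - t).val (L - (s - t).val) ≤ 2 →
      min (β s - β t).val (n - (β s - β t).val) ≤ 2)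
    (J J' : Fin 4 → ZMod n) (hJJ : ¬ ∀ μ, min (J μ - J' μ).val (n - (J μ - J' μ).val) ≤ 4)
    (x : TorusSite 4 L) (hx : ∀ μ, β (x μ) = J μ ∨ β (x μ) + 1 = J μ)
    (y : TorusSite 4 L) (hy : ∀ μ, β (y μ) = J' μ ∨ β (y μ) + 1 = J' μ) :
    3 ≤ torusTaxiDist x y := by
  by_contra hlt
  push Not at hlt
  apply hJJ
  intro μ
  have h1 : min (x μ - y μ).val (L - (x μ - y μ).val) ≤ 2 :=
    (cycAbs_apply_le_torusTaxiDist x y μ).trans (by omega)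
  have h2 := hβ2 _ _ h1
  have hone : ∀ B j : ZMod n, (B = j ∨ B + 1 = j) → min (j - B).val (n - (j - B).val) ≤ 1 := by
    rintro B j (rfl | rfl)
    · simp
    · rw [add_sub_cancel_left]; exact cyclicAbs_one_le
  have h3 : min (J μ - β (x μ)).val (n - (J μ - β (x μ)).val) ≤ 1 := hone _ _ (hx μ)
  have h4 : min (β (y μ) - J' μ).val (n - (β (y μ) - J' μ).val) ≤ 1 := by
    rw [← neg_sub, cyclicAbs_neg]; exact hone _ _ (hy μ)
  have heq : J μ - J' μ = (J μ - β (x μ)) + ((β (x μ) - β (y μ)) + (β (y μ) - J' μ)) := by ring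
  rw [heq]
  calc _ ≤ _ := cyclicAbs_add_le n _ _
    _ ≤ 1 + (min (β (x μ) - β (y μ)).val (n - (β (x μ) - β (y μ)).val) +
          min (β (y μ) - J' μ).val (n - (β (y μ) - J' μ).val)) :=
        add_le_add h3 (cyclicAbs_add_le n _ _)
    _ ≤ 1 + (2 + 1) := by omega
    _ = 4 := rfl

/-- **At most `9⁴` patches are close to a given one.** -/
theorem card_filter_close_le [NeZero n] (J : Fin 4 → ZMod n) :
    (univ.filter fun J' : Fin 4 → ZMod n =>
        ∀ μ, min (J μ - J' μ).val (n - (J μ - J' μ).val) ≤ 4).card ≤ 9 ^ 4 := by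
  set t : Fin 4 → Finset (ZMod n) := fun μ =>
    univ.filter fun j' : ZMod n => min (J μ - j').val (n - (J μ - j').val) ≤ 4 with ht
  have hsub : (univ.filter fun J' : Fin 4 → ZMod n =>
      ∀ μ, min (J μ - J' μ).val (n - (J μ - J' μ).val) ≤ 4) ⊆ Fintype.piFinset t := by
    intro J' hJ'
    rw [Fintype.mem_piFinset]
    intro μ
    simp only [ht, mem_filter, mem_univ, true_and]
    exact (mem_filter.mp hJ').2 μ
  have hcard : ∀ μ, (t μ).card ≤ 9 := by
    intro μ
    have hsub' : t μ ⊆ (univ.filter fun z : ZMod n => min z.val (n - z.val) ≤ 4).image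
        (fun z => J μ - z) := by
      intro j' hj'
      simp only [ht, mem_filter, mem_univ, true_and] at hj'
      exact mem_image.mpr ⟨J μ - j', mem_filter.mpr ⟨mem_univ _, hj'⟩, sub_sub_cancel _ _⟩
    calc (t μ).card ≤ _ := card_le_card hsub'
      _ ≤ (univ.filter fun z : ZMod n => min z.val (n - z.val) ≤ 4).card := card_image_le
      _ ≤ 2 * 4 + 1 := card_filter_cyclicAbs_le_le 4
      _ = 9 := rfl
  calc _ ≤ (Fintype.piFinset t).card := card_le_card hsub
    _ = ∏ μ, (t μ).card := Fintype.card_piFinset t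
    _ ≤ ∏ _μ : Fin 4, 9 := Finset.prod_le_prod (fun μ _ => Nat.zero_le _) (fun μ _ => hcard μ)
    _ = 9 ^ 4 := by simp

/-- **An enlarged box has at most `(4r)⁴` sites** if every block has at most `2r` points. -/
theorem card_box_le [NeZero L] (r : ℕ) (hcard : ∀ j, (univ.filter fun t => β t = j).card ≤ 2 * r)
    (J : Fin 4 → ZMod n) :
    (univ.filter fun x : TorusSite 4 L => ∀ μ, β (x μ) = J μ ∨ β (x μ) + 1 = J μ).card ≤
      (4 * r) ^ 4 := by
  set t : Fin 4 → Finset (ZMod L) := fun μ =>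
    univ.filter fun s : ZMod L => β s = J μ ∨ β s + 1 = J μ with ht
  have hsub : (univ.filter fun x : TorusSite 4 L => ∀ μ, β (x μ) = J μ ∨ β (x μ) + 1 = J μ) ⊆
      Fintype.piFinset t := by
    intro x hx
    rw [Fintype.mem_piFinset]
    intro μ
    simp only [ht, mem_filter, mem_univ, true_and]
    exact (mem_filter.mp hx).2 μ
  have hc : ∀ μ, (t μ).card ≤ 4 * r := by
    intro μ
    have h2 : (univ.filter fun s : ZMod L => β s + 1 = J μ) = univ.filter fun s => β s = J μ - 1 :=
      Finset.filter_congr fun s _ => by rw [eq_sub_iff_add_eq]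
    calc (t μ).card = ((univ.filter fun s : ZMod L => β s = J μ) ∪
          univ.filter fun s : ZMod L => β s + 1 = J μ).card := by
          simp only [ht]; rw [Finset.filter_or]
      _ ≤ (univ.filter fun s : ZMod L => β s = J μ).card +
            (univ.filter fun s : ZMod L => β s + 1 = J μ).card := card_union_le _ _
      _ ≤ 2 * r + 2 * r := add_le_add (hcard _) (by rw [h2]; exact hcard _)
      _ = 4 * r := by ring
  calc _ ≤ (Fintype.piFinset t).card := card_le_card hsub
    _ = ∏ μ, (t μ).card := Fintype.card_piFinset t
    _ ≤ ∏ _μ : Fin 4, (4 * r) := Finset.prod_le_prod (fun μ _ => Nat.zero_le _) (fun μ _ => hc μ)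
    _ = (4 * r) ^ 4 := by simp

end Torus

/-! ## Export: the torus patch system as an existence statement -/

/-- **Helper W3-Aux3 (`stub_windowModesLocalisedAux3`) — the patch system on `(ZMod L)⁴`.**  For `0 < r`,
`2 ≤ n`, `n r ≤ L < (n+1) r` there are partition functions `χ_J : TorusSite 4 L → ℝ`, enlarged boxes `B⁺_J` and
a reflexive symmetric closeness relation on patches `J ∈ (ZMod n)⁴` with: `Σ_J χ_J² = 1`; `supp χ_J ⊆ B⁺_J`;
`Σ_J (χ_J(x + e_μ) − χ_J(x))² ≤ 8/r²`; boxes of non-close patches at taxi distance `≥ 3`; at most `9⁴` patches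
close to a given one; `|B⁺_J| ≤ (4r)⁴`. -/
theorem stub_windowModesLocalisedAux3 : ∀ (L r n : ℕ) [NeZero L] [NeZero n], 0 < r → 2 ≤ n → n * r ≤ L → L < (n + 1) * r → ∃ (χ : (Fin 4 → ZMod n) → TorusSite 4 L → ℝ) (Bplus : (Fin 4 → ZMod n) → Finset (TorusSite 4 L)) (Close : (Fin 4 → ZMod n) → (Fin 4 → ZMod n) → Prop), (∀ x, ∑ J, χ J x ^ 2 = 1) ∧ (∀ J x, χ J x ≠ 0 → x ∈ Bplus J) ∧ (∀ (x : TorusSite 4 L) (μ : Fin 4), ∑ J, (χ J (x + Pi.single μ 1) - χ J x) ^ 2 ≤ 8 / (r : ℝ) ^ 2) ∧ (∀ J, Close J J) ∧ (∀ J J', Close J J' → Close J' J) ∧ (∀ J J', ¬ Close J J' → ∀ x ∈ Bplus J, ∀ y ∈ Bplus J', 3 ≤ torusTaxiDist x y) ∧ (∀ J, (Finset.univ.filter (Close J)).card ≤ 9 ^ 4) ∧ (∀ J, (Bplus J).card ≤ (4 * r) ^ 4) := by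
  intro L r n _ _ hr hn hnr hL
  obtain ⟨β, χ₁, h1, hne, hstep, hβ2, hcard⟩ := stub_windowModesLocalisedAux2 L r n hr hn hnr hL
  refine ⟨fun J x => ∏ μ, χ₁ (J μ) (x μ),
    fun J => univ.filter (fun x : TorusSite 4 L => ∀ μ, β (x μ) = J μ ∨ β (x μ) + 1 = J μ),
    fun J J' => ∀ μ, min (J μ - J' μ).val (n - (J μ - J' μ).val) ≤ 4,
    sum_prod_chi_sq χ₁ h1, mem_box_of_prod_chi_ne_zero β χ₁ hne,
    sum_prod_chi_step_sq_le χ₁ r h1 hstep, fun J μ => by simp, fun J J' h μ => ?_,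
    fun J J' hJJ x hx y hy => three_le_torusTaxiDist_of_not_close β hβ2 J J' hJJ x (mem_filter.mp hx).2
      y (mem_filter.mp hy).2,
    fun J => by simpa using card_filter_close_le J, card_box_le β r hcard⟩
  rw [← neg_sub, cyclicAbs_neg]
  exact h μ

end WindowModes

end Summit.QuantumFields.QCD.Cruxes.ExtinctionBuildsQCD.BlockAwayTheSign

end
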